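import Mathlib
import HarnessLib

/-!
# Compositions of exact kernels are exact: N-hit updates, sweeps and update cycles on a general state space

HONEST FRAMING: exact (Metropolis-corrected) sampling algorithms for lattice gauge theory;
figures of merit are autocorrelation/cost numbers at stated couplings and volumes; no
continuum-physics claim.

Venture `LatticeQCDFlow` (cell pub-lqcd), topic `Exactness`, FANOUT row 9 (eng-latcore).  NEW WORK
of the cell over Mathlib (`ProbabilityTheory.Kernel.Invariant.comp`); nothing is cited as a fact.

The local-update files prove ONE move exact (`SymmetricMetropolis.lean`: "Not here: the N-hit
composition"; `LocalMetropolis.lean`: "Not here: sweeps over links and the N hits per link";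
`PTBCSwap.lean`: "Not here: the composition of a whole PTBC cycle").  All three are the same
one-line fact — `μ`-invariance is closed under kernel composition — recorded here once, in the
shapes the engine uses, so the typed dictionary has no composition gap left.  (Reversibility is NOT
closed under composition; invariance is what survives, and what exactness needs.)

## Content (`κ, η : Kernel α α`, `μ : Measure α`; `Kernel.Invariant κ μ` ⇔ `μ.bind κ = μ`)

* `nHit κ n` — the `n`-fold composition `κ ∘ₖ ⋯ ∘ₖ κ` (`nHit κ 0 = Kernel.id`): the engine's
  `N`-hit Metropolis per link; `invariant_nHit` — invariant if `κ` is.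
* `cycle ks` — the composition of a list of kernels in order (a sweep over links, a 1HB+nOR
  composite, a PTBC cycle of swaps / translations / in-replica updates); `invariant_cycle` —
  invariant if every member is; `invariant_cycle_repeat` — and so is any number of cycles.
* `invariant_id` — the identity kernel is invariant (base case).
-/

namespace Summit.Ventures.LatticeQCDFlow.Exactness

open MeasureTheory ProbabilityTheory ProbabilityTheory.Kernel

variable {α : Type*} [MeasurableSpace α] {μ : Measure α}

/-- The identity kernel leaves every measure invariant. -/
theorem invariant_id : Invariant (Kernel.id : Kernel α α) μ := by
  change μ.bind ⇑(Kernel.id : Kernel α α) = μ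
  exact Measure.bind_dirac

/-- The `n`-fold composition of a kernel with itself: `nHit κ n = κ ∘ₖ ⋯ ∘ₖ κ` (`n` factors). -/
noncomputable def nHit (κ : Kernel α α) : ℕ → Kernel α α
  | 0 => Kernel.id
  | n + 1 => κ ∘ₖ nHit κ n

/-- `nHit κ 0 = id`. -/
@[simp] theorem nHit_zero (κ : Kernel α α) : nHit κ 0 = Kernel.id := rfl

/-- `nHit κ (n+1) = κ ∘ₖ nHit κ n`. -/
@[simp] theorem nHit_succ (κ : Kernel α α) (n : ℕ) : nHit κ (n + 1) = κ ∘ₖ nHit κ n := rfl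

/-- **N-hit updates are exact**: if one hit leaves `μ` invariant, so do `n` hits. -/
theorem invariant_nHit {κ : Kernel α α} (hκ : Invariant κ μ) : ∀ n, Invariant (nHit κ n) μ
  | 0 => invariant_id
  | n + 1 => by rw [nHit_succ]; exact hκ.comp (invariant_nHit hκ n)

/-- The composition of a list of kernels, first element applied LAST (`cycle [κ₁, κ₂] = κ₁ ∘ₖ κ₂`):
a sweep over links, a heat-bath + over-relaxation composite, a PTBC cycle. -/
noncomputable def cycle : List (Kernel α α) → Kernel α α
  | [] => Kernel.id
  | κ :: ks => κ ∘ₖ cycle ks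

/-- `cycle [] = id`. -/
@[simp] theorem cycle_nil : cycle ([] : List (Kernel α α)) = Kernel.id := rfl

/-- `cycle (κ :: ks) = κ ∘ₖ cycle ks`. -/
@[simp] theorem cycle_cons (κ : Kernel α α) (ks : List (Kernel α α)) : cycle (κ :: ks) = κ ∘ₖ cycle ks := rfl

/-- **Update cycles are exact**: if every member of the list leaves `μ` invariant, so does the cycle
— whatever the order and however heterogeneous the members (local hits on different links, swaps,
translations, momentum refreshments). -/
theorem invariant_cycle {ks : List (Kernel α α)} (h : ∀ κ ∈ ks, Invariant κ μ) : Invariant (cycle ks) μ := by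
  induction ks with
  | nil => exact invariant_id
  | cons κ ks ih =>
    rw [cycle_cons]
    exact (h κ List.mem_cons_self).comp (ih fun η hη => h η (List.mem_cons_of_mem κ hη))

/-- Repeating an exact cycle any number of times is exact (a run of `n` sweeps). -/
theorem invariant_cycle_repeat {ks : List (Kernel α α)} (h : ∀ κ ∈ ks, Invariant κ μ) (n : ℕ) :
    Invariant (nHit (cycle ks) n) μ :=
  invariant_nHit (invariant_cycle h) n

/-- Appending cycles composes them: `cycle (ks ++ ls) = cycle ks ∘ₖ cycle ls`. -/
theorem cycle_append (ks ls : List (Kernel α α)) : cycle (ks ++ ls) = cycle ks ∘ₖ cycle ls := by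
  induction ks with
  | nil => simp [Kernel.id_comp]
  | cons κ ks ih => rw [List.cons_append, cycle_cons, cycle_cons, ih, Kernel.comp_assoc]

end Summit.Ventures.LatticeQCDFlow.Exactness
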